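import Summits.BirchSwinnertonDyer.BirchSwinnertonDyer.Theorems.PrintX11aLowerHalfOddPrimeChain
import Summits.BirchSwinnertonDyer.BirchSwinnertonDyer.Theorems.PrintX11aEulerHalfGlue
import HarnessLib

/-!
# Crux `X11aLowerHalf` (item stmt-BirchSwinnertonDyer-19064) at an ODD multiplicative prime — doors and class
# level: the registered stub `stub_lowerThreeDeep` (line birth r3: the lower half at the deep X11a pairs with
# `p = 3`, both images) from named facts + ONE `∀`-hypothesis «certificate + a member with the rational
# equality», and the WHOLE crux body at every odd `p` from the same shape of input
# (`--supports stmt-BirchSwinnertonDyer-19064` helper; seat bsd-line-er5-p2 = -w3 width seat of the 19064 line)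

HONEST FRAMING. Theorems only; no definition, no named fact, no `sorry`; NO route file imported (citable
from a route's `closes`). Nothing here closes the crux or a stub: every theorem is CONDITIONAL on displayed
named facts and on a displayed `∀`-hypothesis whose second component — the rational cyclotomic equality
for one good-ordinary member of `H(E[3])` — has NO printed source at `p = 3` (X. Wan's Thm. 4 is printed
for `p ⩾ 5`), and whose first component is Greenberg's analytic `μ`-statement at the pair (a finite
modular-symbol computation per pair). BSD is not proved for any curve or class by this file.
beyond-print theorem: no.

## What

* §3 `multDivisibilityAt_of_kato_of_surjective_pow` (A32 under `p`-adic surjectivity ⟹ the typed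
  divisibility), `ClassX11a.missingLowerBoundAt_of_member_of_ratEq_of_multDivisibilityAt` ∕
  `…_of_not_surj` ∕ `…_of_surjective_pow` — **the lower half at an X11a pair, ANY odd `p`, either image,
  from the certificate + ONE member with the rational equality + named facts** (sequel of
  `PrintX11aLowerHalfOddPrimeChain.lean` §2 through p607778's endpoint and the height-free rank-`0` socket).
* §4 `lowerThreeDeep_of_forall_muAn_member_ratEq_of_facts` — **the registered stub `stub_lowerThreeDeep`,
  LITERALLY its statement, from 20 named facts + Greenberg–Stevens + ONE `∀`-hypothesis on the deep X11a
  pairs at `3`** («`μ^an(E,3) = 0` ∧ ∃ good-ordinary member of `H(E[3])` with the rational equality»);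
  `x11aLowerHalf_body_of_forall_muAn_member_ratEq_of_facts` — **the WHOLE crux body at every odd `p` from
  the same shape of per-pair input** (at `p ≥ 5` its member component is discharged by Wan's Thm. 4, g0's
  p610393; at `p = 3` it is the residual); `lowerThreeDeep_of_muAnThree_of_forall_member_ratEq_of_facts` —
  the stub from «`μ^an = 0` at multiplicative `3`» AS A STATEMENT (the shape the x11a line p2 announced as
  a class-free theorem modulo Mazur's Manin constant, 2026-08-28) + the member-equality `∀`-hypothesis alone.

READING (lead's call): `stub_lowerThreeDeep` ⟸ `stub_chainFactsLower` read at odd `p` (p612190) + Lemma 20 +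
`stub_pubFactsLower` + ONE new statement on the deep X11a locus at `3` («member-with-equality»; plus the certificate
unless `μ^an = 0` at multiplicative `3` lands as a theorem). See `PrintX11aLowerHalfOddPrimeChain.lean` for the audit.

References: [EmertonPollackWeston2006] Thm. 1, 3.1.1, 5.1.3, p. 5; [Wan2015] Thm. 4; [Wuthrich2014] Thm. 3, Cor. 18–19,
Lemma 20; [Kato2004Asterisque] Thm. 12.4, §17.13; [SteinWuthrich2013] Thm. 6.1; [Miller2011LMS] Def. 1.1.
-/

set_option autoImplicit false
set_option linter.dupNamespace false -- the directory name repeats the summit name (sibling precedent)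

noncomputable section

open scoped Classical MatrixGroups ModularForm

open CongruenceSubgroup UpperHalfPlane WeierstrassCurve Literature.NumberTheory.EllipticCurves
  Literature.NumberTheory.EllipticCurves.ModularForms
  Literature.NumberTheory.EllipticCurves.Rank1Residual
  Literature.NumberTheory.EllipticCurves.Rank1Residual.Typed
  Literature.NumberTheory.EllipticCurves.Wuthrich2014
  Literature.NumberTheory.EllipticCurves.SteinWuthrich2013
  Literature.NumberTheory.EllipticCurves.Greenberg1999
  Literature.NumberTheory.EllipticCurves.Kato2004
  Literature.NumberTheory.EllipticCurves.GreenbergVatsal2000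
  Literature.NumberTheory.EllipticCurves.EmertonPollackWeston2006
  Literature.NumberTheory.GaloisRepresentations
  Summit.BirchSwinnertonDyer.Rank1Residual
  Summit.BirchSwinnertonDyer.Rank1Residual.X1.MuLambda
  Summit.BirchSwinnertonDyer.Rank1Residual.X11a
  Summit.BirchSwinnertonDyer.Rank1Residual.X11a.LambdaNorm
  Summit.BirchSwinnertonDyer.Rank1Residual.X11a.Chain

namespace Summit.BirchSwinnertonDyer.BirchSwinnertonDyer.Theorems.OddChain

/-! ### §3 Doors at a pair on `ClassX11a`, ANY odd `p`, either image: member + rational equality +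
certificate ⟹ the lower half -/

section Doors

variable {W : WeierstrassCurve ℚ} [W.IsElliptic] [W.IsGloballyMinimal] {p : ℕ} [Fact p.Prime]

/-- **The typed divisibility `X11b.MultDivisibilityAt W p` from Kato–Wuthrich A32 under `p`-ADIC surjectivity**
(every `ρ̄_{E,p^n}` onto: Serre at `p ≥ 5`, Wuthrich's Lemma 20 at `p = 3`); same body up to the idle binder
`ϖ ≠ 0`. [cite: Wuthrich2014, Thm. 3 (p. 382), Cor. 19 and Lemma 20 (p. 399)] [cite: Kato2004Asterisque, Thm. 17.4] -/
theorem multDivisibilityAt_of_kato_of_surjective_pow (hKato : kato_charIdeal_dvd_multiplicative_of_surjective)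
    (hp2 : p ≠ 2) (hmult : W.HasMultiplicativeReductionAtPrime p)
    (hsurj' : ∀ n : ℕ, W.HasSurjectiveModNGaloisRep (p ^ n : ℕ)) : X11b.MultDivisibilityAt W p := by
  intro κ γ N _ f hκ hγ hγ' hf D ϖ _ hϖ
  exact hKato W p hp2 hmult hsurj' hκ hγ hγ' hf D ϖ hϖ

/-- **THE LOWER HALF at an X11a pair, ANY odd `p`, EITHER image, from: the typed divisibility
`X11b.MultDivisibilityAt W p` (Kato's side), the certificate `μ^an(E,p) = 0`, ONE good-ordinary member
`(g, ι)` of `H(E[p])` carrying the rational cyclotomic equality (`hRat`, displayed), and named facts**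
(EPW odd-prime ×3, Deligne–Serre 6.1, Hida/Wiles 3.26, modularity, Stein–Wuthrich 6.1 ×2, GZK, GS at the pair):
chain §2 ⟹ `InvariantsMatchAt` ⟹ Mazur's statement at the pair (p607778's endpoint) ⟹ `BSD(E,p)` (height-free
socket) ⟹ `Typed.MissingLowerBoundAt W p`. PER PAIR; CONDITIONAL on the displayed inputs; closes nothing class-wide.
[cite: EmertonPollackWeston2006, Thm. 5.1.3] [cite: SteinWuthrich2013, Thm. 6.1 (p. 20)]
[cite: Miller2011LMS, §1 and Def. 1.1] [cite: Wan2015, Thm. 4 (p. 4) (shape of hRat only)] -/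
theorem _root_.Summit.BirchSwinnertonDyer.Rank1Residual.ClassX11a.missingLowerBoundAt_of_member_of_ratEq_of_multDivisibilityAt
    (hNf : exists_isNewformOf)
    (h311 : thm311_cotorsion_weightK_member_ofLevel_odd) (hT1a : thm1_muAlg_of_weightK_member_ofLevel_odd)
    (hT1b : thm513_transfer_from_weightK_member_of_bdd_ofLevel_odd)
    (h61 : DeligneSerre1974.thm61_exists_adicGaloisRep) (h326 : Hida2000_thm326_ordinary)
    (hJs : thm61_splitMultiplicative) (hJn : thm61_nonsplitMultiplicative)
    (hGZK : rank_eq_analyticRank_of_analyticRank_le_one)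
    (hGS : greenberg_stevens (W := W) (p := p))
    (hX : ClassX11a W p) (hdiv : X11b.MultDivisibilityAt W p) (hμ : X11a.MuAnZeroAt W p)
    {M : ℕ} [NeZero M] (hpM : ¬ p ∣ M) {k : ℤ} (g : CuspForm (Gamma0 M) k)
    (ι : coeffField g →+* PadicAlgCl p) (hmem : IsOrdinaryMemberOfLevel W p g ι)
    (hRat : ∀ (𝔇 : OrdinaryPadicData g p ι) (κ : ZpExtension ℚ p) (γ : Field.absoluteGaloisGroup ℚ),
        κ.IsCyclotomic → κ.IsTopGenerator γ → IsCyclotomicVariable p γ →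
      ∀ (D : GreenbergSelmer.DualData (padicCoeffField (memberGenerators g ι 𝔇.υ)) κ γ 𝔇.ρ 𝔇.plus),
        Module.IsTorsion (PowerSeries (padicCoeffIntegers (memberGenerators g ι 𝔇.υ))) D.X →
      ∀ G : PowerSeries (padicCoeffIntegers (memberGenerators g ι 𝔇.υ)),
        D.charIdeal = Ideal.span {G} →
      ∀ (Dsym : PeriodSymbolDatum g) (L : PowerSeries (PadicAlgCl p)),
        IsCycPAdicLFunctionWeightK g Dsym p ι 𝔇.υ L →
        (∃ C : ℝ, ∀ i, ‖PowerSeries.coeff i L‖ ≤ C) →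
        ∃ (c : PadicAlgCl p) (u : (PowerSeries (padicCoeffIntegers (memberGenerators g ι 𝔇.υ)))ˣ),
          c ≠ 0 ∧
            L = PowerSeries.C c *
              PowerSeries.map (padicCoeffIntegers (memberGenerators g ι 𝔇.υ)).subtype
                ((u : PowerSeries (padicCoeffIntegers (memberGenerators g ι 𝔇.υ))) * G)) :
    MissingLowerBoundAt W p := by
  have hmod : hasEntireLFunction_rat := hasEntireLFunction_rat_of_exists_isNewformOf hNf
  have hpar : nonempty_modularParametrizationData :=
    nonempty_modularParametrizationData_of_exists_isNewformOf hNf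
      IsNewformOf.exists_maninConstant_ne_zero_holds
  have hinv : InvariantsMatchAt W p :=
    invariantsMatchAt_of_member_of_ratEq_of_multDivisibilityAt_odd W p h311 hT1a hT1b h61 h326 hpar
      hX.ne_two hX.mult hX.irr hdiv hμ hpM g ι hmem hRat
  have hMC : X2.MazurMainConjectureAt W p :=
    NonSurjChain.mazurMainConjectureAt_of_invariantsMatchAt_of_multDivisibilityAt hmod W p hGS hdiv
      hX.analyticRank_eq_zero hinv
  exact hX.missingLowerBoundAt_of_bsdp hGZK
    (bsdp_of_mazurMainConjectureAt_heightFree hJs hJn hGZK hmod hpar hGS hX hMC)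

/-- **The lower half at a NON-surjective X11a pair, ANY odd `p` (so `p = 3` with image `3Ns ∕ 3Nn`
included), from the certificate, ONE member with the rational equality, and named facts** — the typed
divisibility from the certificate and Kato 12.4 ∕ §17.13 ×3 ∕ Greenberg 1.5 ∕ Wuthrich Cor. 18 (x11a p3's door,
any odd `p`). At `p ≥ 5` the member input is discharged by Wan (g0's p609759); at `p = 3` it is the residual.
PER PAIR; closes nothing class-wide. [cite: Kato2004Asterisque, Thm. 12.4 (p. 221), §17.13 (pp. 279–280)]
[cite: Wuthrich2014, Cor. 18 (p. 398)] [cite: EmertonPollackWeston2006, Thm. 5.1.3] [cite: Miller2011LMS, Def. 1.1] -/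
theorem _root_.Summit.BirchSwinnertonDyer.Rank1Residual.ClassX11a.missingLowerBoundAt_of_member_of_ratEq_of_not_surj
    (hNf : exists_isNewformOf)
    (h311 : thm311_cotorsion_weightK_member_ofLevel_odd) (hT1a : thm1_muAlg_of_weightK_member_ofLevel_odd)
    (hT1b : thm513_transfer_from_weightK_member_of_bdd_ofLevel_odd)
    (h61 : DeligneSerre1974.thm61_exists_adicGaloisRep) (h326 : Hida2000_thm326_ordinary)
    (h12 : Kato2004.thm12_4)
    (hns : Kato2004.exists_multDivisibilityInputs_nonsplit)
    (hsp : Kato2004.exists_multDivisibilityInputs_split)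
    (h15 : thm15_isTorsion_multiplicative_rat)
    (h18 : Wuthrich2014.corollary18_padicLFunction_mem_iwasawaAlgebra_multiplicative)
    (hfine : Kato2004.exists_multDivisibilityInputs_fine)
    (hJs : thm61_splitMultiplicative) (hJn : thm61_nonsplitMultiplicative)
    (hGZK : rank_eq_analyticRank_of_analyticRank_le_one)
    (hGS : greenberg_stevens (W := W) (p := p))
    (hX : ClassX11a W p) (hnsj : ¬ Surj W p) (hμ : X11a.MuAnZeroAt W p)
    {M : ℕ} [NeZero M] (hpM : ¬ p ∣ M) {k : ℤ} (g : CuspForm (Gamma0 M) k)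
    (ι : coeffField g →+* PadicAlgCl p) (hmem : IsOrdinaryMemberOfLevel W p g ι)
    (hRat : ∀ (𝔇 : OrdinaryPadicData g p ι) (κ : ZpExtension ℚ p) (γ : Field.absoluteGaloisGroup ℚ),
        κ.IsCyclotomic → κ.IsTopGenerator γ → IsCyclotomicVariable p γ →
      ∀ (D : GreenbergSelmer.DualData (padicCoeffField (memberGenerators g ι 𝔇.υ)) κ γ 𝔇.ρ 𝔇.plus),
        Module.IsTorsion (PowerSeries (padicCoeffIntegers (memberGenerators g ι 𝔇.υ))) D.X →
      ∀ G : PowerSeries (padicCoeffIntegers (memberGenerators g ι 𝔇.υ)),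
        D.charIdeal = Ideal.span {G} →
      ∀ (Dsym : PeriodSymbolDatum g) (L : PowerSeries (PadicAlgCl p)),
        IsCycPAdicLFunctionWeightK g Dsym p ι 𝔇.υ L →
        (∃ C : ℝ, ∀ i, ‖PowerSeries.coeff i L‖ ≤ C) →
        ∃ (c : PadicAlgCl p) (u : (PowerSeries (padicCoeffIntegers (memberGenerators g ι 𝔇.υ)))ˣ),
          c ≠ 0 ∧
            L = PowerSeries.C c *
              PowerSeries.map (padicCoeffIntegers (memberGenerators g ι 𝔇.υ)).subtype
                ((u : PowerSeries (padicCoeffIntegers (memberGenerators g ι 𝔇.υ))) * G)) :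
    MissingLowerBoundAt W p :=
  hX.missingLowerBoundAt_of_member_of_ratEq_of_multDivisibilityAt hNf h311 hT1a hT1b h61 h326 hJs hJn
    hGZK hGS (hX.multDivisibilityAt_of_muAnZeroAt_of_not_surj h12 hns hsp h15 h18 hfine hnsj hμ) hμ hpM g ι
    hmem hRat

/-- **The lower half at an X11a pair with `p`-ADICALLY surjective image (every `ρ̄_{E,p^n}` onto —
at `p = 3`: `ρ̄_{E,3}` onto, by Wuthrich's Lemma 20), ANY odd `p`, from the certificate, ONE member with
the rational equality, and named facts** — the typed divisibility from Kato–Wuthrich A32 (`hKato`).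
PER PAIR; closes nothing class-wide. [cite: Wuthrich2014, Thm. 3 (p. 382), Cor. 19 and Lemma 20 (p. 399)]
[cite: EmertonPollackWeston2006, Thm. 5.1.3] [cite: Miller2011LMS, Def. 1.1] -/
theorem _root_.Summit.BirchSwinnertonDyer.Rank1Residual.ClassX11a.missingLowerBoundAt_of_member_of_ratEq_of_surjective_pow
    (hNf : exists_isNewformOf)
    (h311 : thm311_cotorsion_weightK_member_ofLevel_odd) (hT1a : thm1_muAlg_of_weightK_member_ofLevel_odd)
    (hT1b : thm513_transfer_from_weightK_member_of_bdd_ofLevel_odd)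
    (h61 : DeligneSerre1974.thm61_exists_adicGaloisRep) (h326 : Hida2000_thm326_ordinary)
    (hKato : kato_charIdeal_dvd_multiplicative_of_surjective)
    (hJs : thm61_splitMultiplicative) (hJn : thm61_nonsplitMultiplicative)
    (hGZK : rank_eq_analyticRank_of_analyticRank_le_one)
    (hGS : greenberg_stevens (W := W) (p := p))
    (hX : ClassX11a W p) (hsurj' : ∀ n : ℕ, W.HasSurjectiveModNGaloisRep (p ^ n : ℕ))
    (hμ : X11a.MuAnZeroAt W p)
    {M : ℕ} [NeZero M] (hpM : ¬ p ∣ M) {k : ℤ} (g : CuspForm (Gamma0 M) k)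
    (ι : coeffField g →+* PadicAlgCl p) (hmem : IsOrdinaryMemberOfLevel W p g ι)
    (hRat : ∀ (𝔇 : OrdinaryPadicData g p ι) (κ : ZpExtension ℚ p) (γ : Field.absoluteGaloisGroup ℚ),
        κ.IsCyclotomic → κ.IsTopGenerator γ → IsCyclotomicVariable p γ →
      ∀ (D : GreenbergSelmer.DualData (padicCoeffField (memberGenerators g ι 𝔇.υ)) κ γ 𝔇.ρ 𝔇.plus),
        Module.IsTorsion (PowerSeries (padicCoeffIntegers (memberGenerators g ι 𝔇.υ))) D.X →
      ∀ G : PowerSeries (padicCoeffIntegers (memberGenerators g ι 𝔇.υ)),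
        D.charIdeal = Ideal.span {G} →
      ∀ (Dsym : PeriodSymbolDatum g) (L : PowerSeries (PadicAlgCl p)),
        IsCycPAdicLFunctionWeightK g Dsym p ι 𝔇.υ L →
        (∃ C : ℝ, ∀ i, ‖PowerSeries.coeff i L‖ ≤ C) →
        ∃ (c : PadicAlgCl p) (u : (PowerSeries (padicCoeffIntegers (memberGenerators g ι 𝔇.υ)))ˣ),
          c ≠ 0 ∧
            L = PowerSeries.C c *
              PowerSeries.map (padicCoeffIntegers (memberGenerators g ι 𝔇.υ)).subtype
                ((u : PowerSeries (padicCoeffIntegers (memberGenerators g ι 𝔇.υ))) * G)) :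
    MissingLowerBoundAt W p :=
  hX.missingLowerBoundAt_of_member_of_ratEq_of_multDivisibilityAt hNf h311 hT1a hT1b h61 h326 hJs hJn
    hGZK hGS (multDivisibilityAt_of_kato_of_surjective_pow hKato hX.ne_two hX.mult hsurj') hμ hpM g ι hmem
    hRat

end Doors

/-! ### §4 Class level: the crux body at EVERY odd `p` from ONE shape of per-pair input —
(certificate `μ^an(E,p) = 0`, a member of `H(E[p])` with the rational cyclotomic equality) — and the
registered `p = 3` stub of line birth r3 from the same input at `p = 3` -/

section ClassLevel

/-- **The registered stub `stub_lowerThreeDeep` of crux `X11aLowerHalf` (line birth r3) — the lower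
half at the deep X11a pairs with `p = 3`, BOTH images — from named facts + ONE `∀`-hypothesis on that
locus: at every deep X11a pair at `3`, (i) the certificate `μ^an(E,3) = 0` and (ii) SOME good-ordinary member
`(g, ι)` of `H(E[3])` (some level `M`, `3 ∤ M`, some weight) carrying the rational cyclotomic equality
`char_Λ X(ℚ_∞, A_g) = (L_p(g))` in `Λ_𝒪 ⊗ ℚ_p` (X. Wan's Thm. 4 shape — printed only for `p ⩾ 5`; at `p = 3` the
one GL₂ input of the chain with no printed source).** Surjective image ⟹ `3`-adic surjectivity by Lemma 20 (`h20`),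
divisibility by A32 (`hKato`); non-surjective ⟹ divisibility by the Kato §17.13 facts from the certificate.
Members exist (`exists_memberOfLevel_three`, weight `6`); the content of (ii) is the equality. The conclusion is
LITERALLY the registered stub's statement. CONDITIONAL; closes nothing by itself. [cite: EmertonPollackWeston2006, Thm. 1, Thm. 3.1.1, Thm. 5.1.3, Notation p. 5]
[cite: Wan2015, Thm. 4 (p. 4: "Suppose that p ⩾ 5")] [cite: Wuthrich2014, Lemma 20 (p. 399), Cor. 18 (p. 398)]
[cite: Kato2004Asterisque, Thm. 12.4 (p. 221), §17.13 (pp. 279–280)] [cite: Miller2011LMS, Def. 1.1] -/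
theorem lowerThreeDeep_of_forall_muAn_member_ratEq_of_facts
    (hNf : exists_isNewformOf)
    (h311 : thm311_cotorsion_weightK_member_ofLevel_odd) (hT1a : thm1_muAlg_of_weightK_member_ofLevel_odd)
    (hT1b : thm513_transfer_from_weightK_member_of_bdd_ofLevel_odd)
    (h61 : DeligneSerre1974.thm61_exists_adicGaloisRep) (h326 : Hida2000_thm326_ordinary)
    (hKato : kato_charIdeal_dvd_multiplicative_of_surjective)
    (h20 : lemma20_surjective_threeAdic_of_semistable)
    (h12 : Kato2004.thm12_4)
    (hns : Kato2004.exists_multDivisibilityInputs_nonsplit)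
    (hsp : Kato2004.exists_multDivisibilityInputs_split)
    (h15 : thm15_isTorsion_multiplicative_rat)
    (h18 : Wuthrich2014.corollary18_padicLFunction_mem_iwasawaAlgebra_multiplicative)
    (hfine : Kato2004.exists_multDivisibilityInputs_fine)
    (hJs : thm61_splitMultiplicative) (hJn : thm61_nonsplitMultiplicative)
    (hGZK : rank_eq_analyticRank_of_analyticRank_le_one)
    (hGS : ∀ (W : WeierstrassCurve ℚ) [W.IsElliptic] [W.IsGloballyMinimal] (p : ℕ) [Fact p.Prime],
      greenberg_stevens (W := W) (p := p))
    (hcert : ∀ (W : WeierstrassCurve ℚ) [W.IsElliptic] [W.IsGloballyMinimal] (p : ℕ) [Fact p.Prime],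
      ClassX11a W p → p = 3 → ¬ X11a.ShaAnUnit W p →
        X11a.MuAnZeroAt W p ∧
        ∃ (M : ℕ) (_ : NeZero M) (_ : ¬ p ∣ M) (k : ℤ) (g : CuspForm (Gamma0 M) k)
          (ι : coeffField g →+* PadicAlgCl p), IsOrdinaryMemberOfLevel W p g ι ∧
          ∀ (𝔇 : OrdinaryPadicData g p ι) (κ : ZpExtension ℚ p) (γ : Field.absoluteGaloisGroup ℚ),
            κ.IsCyclotomic → κ.IsTopGenerator γ → IsCyclotomicVariable p γ →
          ∀ (D : GreenbergSelmer.DualData (padicCoeffField (memberGenerators g ι 𝔇.υ)) κ γ 𝔇.ρ 𝔇.plus),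
            Module.IsTorsion (PowerSeries (padicCoeffIntegers (memberGenerators g ι 𝔇.υ))) D.X →
          ∀ G : PowerSeries (padicCoeffIntegers (memberGenerators g ι 𝔇.υ)),
            D.charIdeal = Ideal.span {G} →
          ∀ (Dsym : PeriodSymbolDatum g) (L : PowerSeries (PadicAlgCl p)),
            IsCycPAdicLFunctionWeightK g Dsym p ι 𝔇.υ L →
            (∃ C : ℝ, ∀ i, ‖PowerSeries.coeff i L‖ ≤ C) →
            ∃ (c : PadicAlgCl p) (u : (PowerSeries (padicCoeffIntegers (memberGenerators g ι 𝔇.υ)))ˣ),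
              c ≠ 0 ∧
                L = PowerSeries.C c *
                  PowerSeries.map (padicCoeffIntegers (memberGenerators g ι 𝔇.υ)).subtype
                    ((u : PowerSeries (padicCoeffIntegers (memberGenerators g ι 𝔇.υ))) * G)) :
    ∀ (W : WeierstrassCurve ℚ) [W.IsElliptic] [W.IsGloballyMinimal] (p : ℕ) [Fact p.Prime],
      ClassX11a W p → p = 3 → ¬ X11a.ShaAnUnit W p → MissingLowerBoundAt W p := by
  intro W _ _ p _ hX hp3 hu
  obtain ⟨hμ, M, _, hpM, k, g, ι, hmem, hRat⟩ := hcert W p hX hp3 hu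
  by_cases hsurj : Surj W p
  · -- surjective image: `3`-adic surjectivity by Lemma 20, divisibility by Kato–Wuthrich A32
    have hsurj' : ∀ n : ℕ, W.HasSurjectiveModNGaloisRep (p ^ n : ℕ) := by
      subst hp3
      exact h20 W (Or.inr hX.mult) hsurj
    exact hX.missingLowerBoundAt_of_member_of_ratEq_of_surjective_pow hNf h311 hT1a hT1b h61 h326 hKato
      hJs hJn hGZK (hGS W p) hsurj' hμ hpM g ι hmem hRat
  · exact hX.missingLowerBoundAt_of_member_of_ratEq_of_not_surj hNf h311 hT1a hT1b h61 h326 h12 hns hsp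
      h15 h18 hfine hJs hJn hGZK (hGS W p) hsurj hμ hpM g ι hmem hRat

/-- **The WHOLE body of crux `X11aLowerHalf` (`∀` X11a pairs, the lower half — the unfolding of
`Theses.ErratumRoadFive.X11aLowerHalf` = `Theses.PrintX11a.X11aLowerHalf`; no route file imported) at
EVERY odd `p` from ONE SHAPE of per-pair input on the deep pairs**: (certificate `μ^an(E,p) = 0`, a good-ordinary
member of `H(E[p])` with the rational cyclotomic equality). At `p ≥ 5` the member component is DISCHARGED by Wan's
Thm. 4 + the modularity-produced member (g0's p610393); at `p = 3` it is the residual. Surjective image ⟹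
`p`-adic surjectivity (Serre at `p ≥ 5`, Lemma 20 at `3`); non-surjective ⟹ the x11a p3 door; unit pairs free.
CONDITIONAL; closes nothing by itself.
[cite: EmertonPollackWeston2006, Thm. 1, Thm. 3.1.1, Thm. 5.1.3, Notation p. 5] [cite: Wan2015, Thm. 4 (p. 4)]
[cite: Wuthrich2014, Cor. 19 and Lemma 20 (p. 399)] [cite: GreenbergLNM1716, Conj. 1.11 (shape)] [cite: Miller2011LMS, Def. 1.1] -/
theorem x11aLowerHalf_body_of_forall_muAn_member_ratEq_of_facts
    (hNf : exists_isNewformOf)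
    (h311 : thm311_cotorsion_weightK_member_ofLevel_odd) (hT1a : thm1_muAlg_of_weightK_member_ofLevel_odd)
    (hT1b : thm513_transfer_from_weightK_member_of_bdd_ofLevel_odd)
    (h61 : DeligneSerre1974.thm61_exists_adicGaloisRep) (h326 : Hida2000_thm326_ordinary)
    (hKato : kato_charIdeal_dvd_multiplicative_of_surjective)
    (h20 : lemma20_surjective_threeAdic_of_semistable)
    (h12 : Kato2004.thm12_4)
    (hns : Kato2004.exists_multDivisibilityInputs_nonsplit)
    (hsp : Kato2004.exists_multDivisibilityInputs_split)
    (h15 : thm15_isTorsion_multiplicative_rat)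
    (h18 : Wuthrich2014.corollary18_padicLFunction_mem_iwasawaAlgebra_multiplicative)
    (hfine : Kato2004.exists_multDivisibilityInputs_fine)
    (hJs : thm61_splitMultiplicative) (hJn : thm61_nonsplitMultiplicative)
    (hGZK : rank_eq_analyticRank_of_analyticRank_le_one)
    (hGS : ∀ (W : WeierstrassCurve ℚ) [W.IsElliptic] [W.IsGloballyMinimal] (p : ℕ) [Fact p.Prime],
      greenberg_stevens (W := W) (p := p))
    (hcert : ∀ (W : WeierstrassCurve ℚ) [W.IsElliptic] [W.IsGloballyMinimal] (p : ℕ) [Fact p.Prime],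
      ClassX11a W p → ¬ X11a.ShaAnUnit W p →
        X11a.MuAnZeroAt W p ∧
        ∃ (M : ℕ) (_ : NeZero M) (_ : ¬ p ∣ M) (k : ℤ) (g : CuspForm (Gamma0 M) k)
          (ι : coeffField g →+* PadicAlgCl p), IsOrdinaryMemberOfLevel W p g ι ∧
          ∀ (𝔇 : OrdinaryPadicData g p ι) (κ : ZpExtension ℚ p) (γ : Field.absoluteGaloisGroup ℚ),
            κ.IsCyclotomic → κ.IsTopGenerator γ → IsCyclotomicVariable p γ →
          ∀ (D : GreenbergSelmer.DualData (padicCoeffField (memberGenerators g ι 𝔇.υ)) κ γ 𝔇.ρ 𝔇.plus),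
            Module.IsTorsion (PowerSeries (padicCoeffIntegers (memberGenerators g ι 𝔇.υ))) D.X →
          ∀ G : PowerSeries (padicCoeffIntegers (memberGenerators g ι 𝔇.υ)),
            D.charIdeal = Ideal.span {G} →
          ∀ (Dsym : PeriodSymbolDatum g) (L : PowerSeries (PadicAlgCl p)),
            IsCycPAdicLFunctionWeightK g Dsym p ι 𝔇.υ L →
            (∃ C : ℝ, ∀ i, ‖PowerSeries.coeff i L‖ ≤ C) →
            ∃ (c : PadicAlgCl p) (u : (PowerSeries (padicCoeffIntegers (memberGenerators g ι 𝔇.υ)))ˣ),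
              c ≠ 0 ∧
                L = PowerSeries.C c *
                  PowerSeries.map (padicCoeffIntegers (memberGenerators g ι 𝔇.υ)).subtype
                    ((u : PowerSeries (padicCoeffIntegers (memberGenerators g ι 𝔇.υ))) * G)) :
    ∀ (W : WeierstrassCurve ℚ) [W.IsElliptic] [W.IsGloballyMinimal] (p : ℕ) [Fact p.Prime],
      ClassX11a W p → MissingLowerBoundAt W p := by
  intro W _ _ p hpF hX
  by_cases hu : X11a.ShaAnUnit W p
  · exact x11a_missingLowerBoundAt_of_shaAnUnit hu
  obtain ⟨hμ, M, _, hpM, k, g, ι, hmem, hRat⟩ := hcert W p hX hu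
  by_cases hsurj : Surj W p
  · have hsurj' : ∀ n : ℕ, W.HasSurjectiveModNGaloisRep (p ^ n : ℕ) := by
      by_cases hp3 : p = 3
      · subst hp3
        exact h20 W (Or.inr hX.mult) hsurj
      · exact kato_charIdeal_dvd_multiplicative_of_surjective.surjective_pow_of_five_le W p
          ((Fact.out : p.Prime).five_le_of_ne_two_of_ne_three hX.ne_two hp3) hsurj
    exact hX.missingLowerBoundAt_of_member_of_ratEq_of_surjective_pow hNf h311 hT1a hT1b h61 h326 hKato
      hJs hJn hGZK (hGS W p) hsurj' hμ hpM g ι hmem hRat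
  · exact hX.missingLowerBoundAt_of_member_of_ratEq_of_not_surj hNf h311 hT1a hT1b h61 h326 h12 hns hsp
      h15 h18 hfine hJs hJn hGZK (hGS W p) hsurj hμ hpM g ι hmem hRat

/-- **`stub_lowerThreeDeep` from Greenberg's analytic `μ = 0` at multiplicative `3` AS A STATEMENT
(`hμ3`: `∀ E`, `3 ∥ N`, `E[3]` irreducible ⟹ `μ^an(E,3) = 0` — the shape of the class-free theorem the
x11a line p2 announced 2026-08-28, `MultThreeMuAn.muAnZeroAt_three_of_mult_of_irr`, modulo Mazur's Manin
constant) + the member-with-rational-equality `∀`-hypothesis ALONE + named facts.** Once `hμ3` is a tree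
theorem, the `p = 3` content of crux `X11aLowerHalf` is EXACTLY «one good-ordinary member of `H(E[3])`
with the rational cyclotomic equality, per deep X11a pair at `3`» (X. Wan's Thm. 4 at `p = 3`; not in
print). CONDITIONAL; closes nothing by itself. [cite: GreenbergLNM1716, Conj. 1.11 (shape)]
[cite: Wan2015, Thm. 4 (p. 4: "Suppose that p ⩾ 5")] [cite: EmertonPollackWeston2006, Thm. 5.1.3] [cite: Miller2011LMS, Def. 1.1] -/
theorem lowerThreeDeep_of_muAnThree_of_forall_member_ratEq_of_facts
    (hNf : exists_isNewformOf)
    (h311 : thm311_cotorsion_weightK_member_ofLevel_odd) (hT1a : thm1_muAlg_of_weightK_member_ofLevel_odd)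
    (hT1b : thm513_transfer_from_weightK_member_of_bdd_ofLevel_odd)
    (h61 : DeligneSerre1974.thm61_exists_adicGaloisRep) (h326 : Hida2000_thm326_ordinary)
    (hKato : kato_charIdeal_dvd_multiplicative_of_surjective)
    (h20 : lemma20_surjective_threeAdic_of_semistable)
    (h12 : Kato2004.thm12_4)
    (hns : Kato2004.exists_multDivisibilityInputs_nonsplit)
    (hsp : Kato2004.exists_multDivisibilityInputs_split)
    (h15 : thm15_isTorsion_multiplicative_rat)
    (h18 : Wuthrich2014.corollary18_padicLFunction_mem_iwasawaAlgebra_multiplicative)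
    (hfine : Kato2004.exists_multDivisibilityInputs_fine)
    (hJs : thm61_splitMultiplicative) (hJn : thm61_nonsplitMultiplicative)
    (hGZK : rank_eq_analyticRank_of_analyticRank_le_one)
    (hGS : ∀ (W : WeierstrassCurve ℚ) [W.IsElliptic] [W.IsGloballyMinimal] (p : ℕ) [Fact p.Prime],
      greenberg_stevens (W := W) (p := p))
    (hμ3 : ∀ (W : WeierstrassCurve ℚ) [W.IsElliptic] [W.IsGloballyMinimal],
      W.HasMultiplicativeReductionAtPrime 3 → W.HasIrreducibleModPGaloisRep 3 → X11a.MuAnZeroAt W 3)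
    (hmem : ∀ (W : WeierstrassCurve ℚ) [W.IsElliptic] [W.IsGloballyMinimal] (p : ℕ) [Fact p.Prime],
      ClassX11a W p → p = 3 → ¬ X11a.ShaAnUnit W p →
        ∃ (M : ℕ) (_ : NeZero M) (_ : ¬ p ∣ M) (k : ℤ) (g : CuspForm (Gamma0 M) k)
          (ι : coeffField g →+* PadicAlgCl p), IsOrdinaryMemberOfLevel W p g ι ∧
          ∀ (𝔇 : OrdinaryPadicData g p ι) (κ : ZpExtension ℚ p) (γ : Field.absoluteGaloisGroup ℚ),
            κ.IsCyclotomic → κ.IsTopGenerator γ → IsCyclotomicVariable p γ →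
          ∀ (D : GreenbergSelmer.DualData (padicCoeffField (memberGenerators g ι 𝔇.υ)) κ γ 𝔇.ρ 𝔇.plus),
            Module.IsTorsion (PowerSeries (padicCoeffIntegers (memberGenerators g ι 𝔇.υ))) D.X →
          ∀ G : PowerSeries (padicCoeffIntegers (memberGenerators g ι 𝔇.υ)),
            D.charIdeal = Ideal.span {G} →
          ∀ (Dsym : PeriodSymbolDatum g) (L : PowerSeries (PadicAlgCl p)),
            IsCycPAdicLFunctionWeightK g Dsym p ι 𝔇.υ L →
            (∃ C : ℝ, ∀ i, ‖PowerSeries.coeff i L‖ ≤ C) →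
            ∃ (c : PadicAlgCl p) (u : (PowerSeries (padicCoeffIntegers (memberGenerators g ι 𝔇.υ)))ˣ),
              c ≠ 0 ∧
                L = PowerSeries.C c *
                  PowerSeries.map (padicCoeffIntegers (memberGenerators g ι 𝔇.υ)).subtype
                    ((u : PowerSeries (padicCoeffIntegers (memberGenerators g ι 𝔇.υ))) * G)) :
    ∀ (W : WeierstrassCurve ℚ) [W.IsElliptic] [W.IsGloballyMinimal] (p : ℕ) [Fact p.Prime],
      ClassX11a W p → p = 3 → ¬ X11a.ShaAnUnit W p → MissingLowerBoundAt W p :=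
  lowerThreeDeep_of_forall_muAn_member_ratEq_of_facts hNf h311 hT1a hT1b h61 h326 hKato h20 h12 hns hsp h15
    h18 hfine hJs hJn hGZK hGS fun W _ _ p _ hX hp3 hu =>
      ⟨by subst hp3; exact hμ3 W hX.mult hX.irr, hmem W p hX hp3 hu⟩

end ClassLevel

end Summit.BirchSwinnertonDyer.BirchSwinnertonDyer.Theorems.OddChain

end
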